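import Literature.NumberTheory.GaloisRepresentations.LubinTateColemanLogDerivSurjModTwo
import HarnessLib

/-!
# `δ(ℳ_f¹)` is `π`-adically dense in the `𝒮`-eigenseries at `q = 2` (de Shalit I §3.12 Corollary,
# successive approximation)

De Shalit, *Iwasawa theory of elliptic curves with complex multiplication* (1987), Ch. I §3.12 Corollary:
"`δ(ℳ) mod 𝔭' = 𝓔/p𝓔`, so `δ(ℳ) = 𝓔`".  The passage from the congruence modulo `𝔭'` to equality is a
successive approximation; this file proves its ALGEBRAIC form for `f = πX + X²` over any local field `F` with
`|𝓀_F| = 2` whose uniformiser is congruent to a natural number modulo `π²` (e.g. `F = ℚ₂`, any `π`, `m₁ = 2`):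

* ★★ `exists_colemanNorm_eq_sub_logDeriv_mem_pow` — for every `N ≥ 1` and every `h` with `𝒮h = π h` there is an
  `𝒩`-invariant principal unit `g` with **`h ≡ δg (mod π^N)`**.

Step `N → N+1`: `h − δG = π^N h_N` with `h_N` again an eigenseries (`exists_eq_C_pow_mul_of_colemanTrace_eq`),
`h_N ≡ δg_N (mod π)` (`LubinTateColemanLogDerivSurjModTwo.lean`), `π^N ≡ m₁^N (mod π^{N+1})`
(`pow_succ_dvd_pow_sub_pow`), `G' = G · g_N^{m₁^N}` and `δ(g^m) = m δg`.  The remaining (topological) half of the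
Corollary — `ℳ_f¹` compact, `δ` continuous, hence `δ(ℳ_f¹) = 𝓔_π` for `F = ℚ₂` — is left to the consumer's
topology.  Everything here is proved (0 sorry).

## References

* E. de Shalit, *Iwasawa theory of elliptic curves with complex multiplication* (1987), Ch. I §3.12 Corollary. [deShalit1987]
-/

noncomputable section

open scoped PowerSeries.WithPiTopology

/-! ## `δ(ℳ_f¹)` is `π`-adically dense in the `𝒮`-eigenseries (q = 2): the successive approximation of
de Shalit I §3.12 Corollary -/

namespace Literature.NumberTheory.GaloisRepresentations

section LocalFieldDense

open GaloisRepresentations.IsNonarchimedeanLocalField LubinTate ValuativeRel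

variable (F : Type*) [Field F] [ValuativeRel F] [TopologicalSpace F] [IsNonarchimedeanLocalField F]

attribute [local instance] ltNormUniformSpace ltNormIsUniformAddGroup rk1 nF nE fintypeResidueField

variable {F}
variable {π : 𝒪[F]} (hπ : (valuation F).IsUniformizer (π : F)) (n : ℕ)

/-- `δ(g^m) = m · δg`. [cite: deShalit1987, Ch. I §3.4 Lemma (i)] -/
theorem logDeriv_pow (g : (PowerSeries (LTCoeff F))ˣ) (m : ℕ) :
    logDeriv hπ (g ^ m) = (m : PowerSeries (LTCoeff F)) * logDeriv hπ g := by
  induction m with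
  | zero => rw [pow_zero, logDeriv_one, Nat.cast_zero, zero_mul]
  | succ m ih => rw [pow_succ, logDeriv_mul, ih]; push_cast; ring

/-- **Eigenseries divisible by `π^N` are `π^N` times eigenseries** (`𝒮` is `𝒪[F]`-linear and `𝒪[F]⟦X⟧` has no
`π`-torsion). [cite: deShalit1987, Ch. I §3.12 Corollary (proof)] -/
theorem exists_eq_C_pow_mul_of_colemanTrace_eq (N : ℕ) (h : PowerSeries (LTCoeff F))
    (hh : colemanTrace hπ n h = PowerSeries.C (LTCoeff.of F π) * h)
    (hN : h ∈ coeffIdeal (Ideal.span {LTCoeff.of F π ^ N})) :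
    ∃ h' : PowerSeries (LTCoeff F), h = PowerSeries.C (LTCoeff.of F π ^ N) * h' ∧
      colemanTrace hπ n h' = PowerSeries.C (LTCoeff.of F π) * h' := by
  haveI : IsDomain (LTCoeff F) := inferInstanceAs (IsDomain 𝒪[F])
  have hπ0 : LTCoeff.of F π ≠ 0 := fun h0 => hπ.ne_zero (by
    have := congrArg (fun x => (((LTCoeff.of F).symm x : 𝒪[F]) : F)) h0
    simpa using this)
  obtain ⟨h', hh'⟩ := exists_eq_C_mul_of_mem_coeffIdeal_span hN
  refine ⟨h', hh', ?_⟩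
  have e : PowerSeries.C (LTCoeff.of F π ^ N) * colemanTrace hπ n h' =
      PowerSeries.C (LTCoeff.of F π ^ N) * (PowerSeries.C (LTCoeff.of F π) * h') := by
    rw [← colemanTrace_C_mul, ← hh', hh, hh']; ring
  have hC0 : (PowerSeries.C (LTCoeff.of F π ^ N) : PowerSeries (LTCoeff F)) ≠ 0 := by
    intro h0
    have := congrArg PowerSeries.constantCoeff h0
    rw [PowerSeries.constantCoeff_C, map_zero] at this
    exact pow_ne_zero N hπ0 this
  exact mul_left_cancel₀ hC0 e

omit [TopologicalSpace F] [IsNonarchimedeanLocalField F] in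
/-- `π² ∣ π − m ⟹ π^{N+1} ∣ π^N − m^N` (`N ≥ 1`). [folklore] -/
private theorem pow_succ_dvd_pow_sub_pow {R : Type*} [CommRing R] {ϖ m : R} (h : ϖ ^ 2 ∣ ϖ - m) (N : ℕ) (hN : 1 ≤ N) :
    ϖ ^ (N + 1) ∣ ϖ ^ N - m ^ N := by
  have hm : ϖ ∣ m := by
    obtain ⟨c, hc⟩ := h
    exact ⟨1 - ϖ * c, by linear_combination -hc⟩
  induction N, hN using Nat.le_induction with
  | base => simpa using h
  | succ N hN ih =>
    have e : ϖ ^ (N + 1) - m ^ (N + 1) = ϖ * (ϖ ^ N - m ^ N) + (ϖ - m) * m ^ N := by ring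
    rw [e, pow_succ']
    refine dvd_add (mul_dvd_mul (dvd_refl ϖ) ih) ?_
    have h2 : ϖ ^ 2 * ϖ ^ N ∣ (ϖ - m) * m ^ N := mul_dvd_mul h (pow_dvd_pow_of_dvd hm N)
    have e2 : ϖ * ϖ ^ (N + 1) = ϖ ^ 2 * ϖ ^ N := by ring
    rw [e2]
    exact h2

/-- `𝒮(h − h') = 𝒮h − 𝒮h'`. [cite: deShalit1987, Ch. I §3.12] -/
theorem colemanTrace_sub (h h' : PowerSeries (LTCoeff F)) :
    colemanTrace hπ n (h - h') = colemanTrace hπ n h - colemanTrace hπ n h' := by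
  have e : h - h' = h + PowerSeries.C (-1 : LTCoeff F) * h' := by rw [map_neg, map_one]; ring
  rw [e, colemanTrace_add, colemanTrace_C_mul, map_neg, map_one]
  ring

omit [TopologicalSpace F] [IsNonarchimedeanLocalField F] in
/-- `C(a) · G ∈ coeffIdeal (a · J)`-type bookkeeping: `a ∈ (s)`, `G ∈ coeffIdeal (t)` ⟹ `C a · G ∈ coeffIdeal (s t)`.
[folklore] -/
private theorem C_mul_mem_coeffIdeal_span_mul {a s t : LTCoeff F} (ha : a ∈ Ideal.span {s}) {G : PowerSeries (LTCoeff F)}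
    (hG : G ∈ coeffIdeal (Ideal.span {t})) : PowerSeries.C a * G ∈ coeffIdeal (Ideal.span {s * t}) := by
  intro k
  rw [PowerSeries.coeff_C_mul, ← Ideal.span_singleton_mul_span_singleton]
  exact Ideal.mul_mem_mul ha (hG k)

/-- ★★ **Successive approximation** (de Shalit I §3.12 Corollary: "`δ(ℳ) mod 𝔭' = 𝓔/p𝓔`, so `δ(ℳ) = 𝓔`" — the
algebraic half): at `q = 2`, if the uniformiser is congruent to a natural number modulo `π²`
(`∃ m₁, π² ∣ π − m₁`; true for `F = ℚ₂` with ANY `π`, `m₁ = 2`), then for every `N ≥ 1` and every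
`𝒮`-eigenseries `h` there is an `𝒩`-invariant principal unit `g` with **`h ≡ δg (mod π^N)`**: `δ(ℳ_f¹)` is
`π`-adically dense in `𝓔_π`.  (Step: `h − δG = π^N h_N`, `h_N ∈ 𝓔`, `h_N ≡ δg_N (mod π)`, `π^N ≡ m₁^N (mod π^{N+1})`,
`G' = G·g_N^{m₁^N}`.) [cite: deShalit1987, Ch. I §3.12 Corollary] -/
theorem exists_colemanNorm_eq_sub_logDeriv_mem_pow (hq : residueFieldCard F = 2)
    (hm : ∃ m₁ : ℕ, LTCoeff.of F π ^ 2 ∣ LTCoeff.of F π - m₁) (N : ℕ) (hN : 1 ≤ N)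
    (h : PowerSeries (LTCoeff F)) (hh : colemanTrace hπ n h = PowerSeries.C (LTCoeff.of F π) * h) :
    ∃ g : (PowerSeries (LTCoeff F))ˣ, colemanNorm hπ n (g : PowerSeries (LTCoeff F)) = g ∧
      PowerSeries.constantCoeff (g : PowerSeries (LTCoeff F)) - 1 ∈ Ideal.span {LTCoeff.of F π} ∧
      h - logDeriv hπ g ∈ coeffIdeal (Ideal.span {LTCoeff.of F π ^ N}) := by
  obtain ⟨m₁, hm₁⟩ := hm
  induction N, hN using Nat.le_induction generalizing h with
  | base =>
    obtain ⟨g, hNg, hg0, hg⟩ := exists_colemanNorm_eq_sub_logDeriv_mem hπ n hq h hh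
    exact ⟨g, hNg, hg0, by rwa [pow_one]⟩
  | succ N hN1 ih =>
    obtain ⟨G, hNG, hG0, hG⟩ := ih h hh
    -- `h - δG = π^N · h_N` with `h_N ∈ 𝓔`
    have hE : colemanTrace hπ n (h - logDeriv hπ G) = PowerSeries.C (LTCoeff.of F π) * (h - logDeriv hπ G) := by
      rw [colemanTrace_sub, hh, colemanTrace_logDeriv_of_colemanNorm_eq hπ n G hNG, mul_sub]
    obtain ⟨hN', hhN', hEN⟩ := exists_eq_C_pow_mul_of_colemanTrace_eq hπ n N _ hE hG
    -- `h_N ≡ δ g_N (mod π)`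
    obtain ⟨gN, hNgN, hgN0, hgN⟩ := exists_colemanNorm_eq_sub_logDeriv_mem hπ n hq hN' hEN
    -- the integer exponent `m₁^N ≡ π^N (mod π^{N+1})`
    have hmN := pow_succ_dvd_pow_sub_pow hm₁ N hN1
    refine ⟨G * gN ^ (m₁ ^ N), ?_, ?_, ?_⟩
    · -- `𝒩`-invariance
      have e1 : Units.map (colemanNormHom hπ n) G = G := Units.ext hNG
      have e2 : Units.map (colemanNormHom hπ n) gN = gN := Units.ext hNgN
      have e3 : Units.map (colemanNormHom hπ n) (G * gN ^ (m₁ ^ N)) = G * gN ^ (m₁ ^ N) := by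
        rw [map_mul, map_pow, e1, e2]
      have := congrArg (fun v : (PowerSeries (LTCoeff F))ˣ => (v : PowerSeries (LTCoeff F))) e3
      simpa only [Units.coe_map, colemanNormHom_apply] using this
    · -- principal
      have key : ∀ x : LTCoeff F, x - 1 ∈ Ideal.span {LTCoeff.of F π} ↔
          IsLocalRing.residue 𝒪[F] ((LTCoeff.of F).symm x) = 1 := fun x => by
        rw [← residue_eq_zero_iff_mem hπ, map_sub, map_sub, map_one, map_one, sub_eq_zero]
      rw [key] at hG0 hgN0 ⊢
      rw [Units.val_mul, Units.val_pow_eq_pow_val, map_mul, map_pow, map_mul, map_pow, map_mul, map_pow, hG0,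
        hgN0, one_pow, mul_one]
    · -- the congruence modulo `π^{N+1}`
      have e : h - logDeriv hπ (G * gN ^ (m₁ ^ N)) =
          PowerSeries.C (LTCoeff.of F π ^ N) * (hN' - logDeriv hπ gN) +
            PowerSeries.C (LTCoeff.of F π ^ N - (m₁ : LTCoeff F) ^ N) * logDeriv hπ gN := by
        have e1 : PowerSeries.C (LTCoeff.of F π ^ N - (m₁ : LTCoeff F) ^ N) =
            PowerSeries.C (LTCoeff.of F π ^ N) - ((m₁ : PowerSeries (LTCoeff F))) ^ N := by
          rw [map_sub, map_pow (PowerSeries.C) (m₁ : LTCoeff F) N, map_natCast]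
        rw [logDeriv_mul, logDeriv_pow, Nat.cast_pow, e1]
        linear_combination hhN'
      rw [e]
      refine add_mem ?_ ?_
      · have := C_mul_mem_coeffIdeal_span_mul (Ideal.mem_span_singleton_self (LTCoeff.of F π ^ N)) hgN
        rwa [← pow_succ] at this
      · exact C_mul_mem_coeffIdeal (Ideal.mem_span_singleton.mpr hmN) _

end LocalFieldDense

end Literature.NumberTheory.GaloisRepresentations
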